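/-
Copyright (c) 2026 the pub-hodgecm-mathlib formalisation cell (harness21).  Prover seat hodgecm-mathlib-A-p14 (g32), P6 «MOD programme»,
P6a desk F0P6a-plan (g1) ORGAN DEALS #1 (O-α) «HECKE–SERRE CONSTRUCTOR», FILE α1; 2026-09-01.
-/
import Literature.AlgebraicGeometry.AbelianSchemes.AbelianSchemeQuotientHomDescent
import Literature.AlgebraicGeometry.AbelianSchemes.AbelianSchemeOverRingAction
import Literature.AlgebraicGeometry.AbelianSchemes.PolarizationLamTranslationInvariance
import HarnessLib

/-!
# The `𝒪`-action on the quotient `A ∕ K` by a stable finite constant subgroup: `ρ′ := ρ` descended along `ψ : A → A∕K`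
# ([MumfordAV1970] §7 Thm. 4; [Kottwitz1992] §5; [RapoportSmithlingZhang2020Diagonal] (4.23))

Topic `AlgebraicGeometry/AbelianSchemes`, namespace `Literature.AlgebraicGeometry.AbelianSchemes.AbelianSchemeOver`.  ONE construction with body
(`RingAction.quotient`) + proved theorems; no named fact, no `instance`, no notation, no `sorry`.  Cell `hodgecm-mathlib` (D-0151), F0/P6 «MOD», P6a
desk F0P6a-plan (g1) ORGAN DEALS #1 **(O-α) «HECKE–SERRE CONSTRUCTOR», FILE α1 = row Q3 of the census** (the only row of the quotient step that was not
★ by name: ★ `quotientBy` (Q1), ★ `comp_quotientMk_eq_one_iff_of_range` (Q2), ★ `polarizationDesc` (Q5), ★ `LevelStructure.exists_comp_of_torsionBijOn` (Q6)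
supply the other components of `(A∕K, ρ′, D′, pol′, lvl′)`); `--supports stmt-HodgeConjecture-24832`, COUNT-NEUTRAL.  HONEST LABEL: HC_CM is proved only
modulo the 2 remaining named inputs (hLiu418 24832, h413 24833) until rung 0 closes; this file discharges none of them.

## Mathematics

Let `A → S` be an abelian scheme with an action `ρ : 𝒪 → End_S(A)` by homomorphisms (★ `RingAction`), `K ≤ A(S)` a finite group of sections
with the standing hypotheses of the tree's quotient ★ `quotientBy u K hcov hG hsm hgc` (`u : S → Y`, `Y` affine; `hfree`: `K` acts freely on geometric
points), and suppose `K` is `ρ`-STABLE: `σ ∈ K ⇒ σ ≫ ρ(a) ∈ K` for every `a ∈ 𝒪`.  Then each `ρ(a) ≫ ψ : A → A∕K` is `K`-invariant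
(`t_σ ≫ ρ(a) ≫ ψ = ρ(a) ≫ t_{σ ≫ ρ(a)} ≫ ψ = ρ(a) ≫ ψ`, ★ `translation_comp_of_isMonHom`, ★ `translation_comp_quotientMk`), so it DESCENDS uniquely to
`ρ′(a) := homDesc (ρ(a) ≫ ψ) : A∕K → A∕K` (★ `homDesc`, a homomorphism by ★ `isMonHom_homDesc`), characterised by **`ψ ≫ ρ′(a) = ρ(a) ≫ ψ`**; uniqueness
after the epimorphism `ψ` (★ `epi_quotientMk`) gives `ρ′(1) = 𝟙`, `ρ′(ab) = ρ′(b) ≫ ρ′(a)`, `ρ′(0) = 1`, `ρ′(a + b) = ρ′(a)·ρ′(b)` — i.e. **`ρ′` is a ring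
action on `A∕K` and `ψ` is `𝒪`-equivariant** ([MumfordAV1970] §7 Thm. 4 p. 72: the universal property of `A → A∕K`; this is the `ι_{A′}` of the isogeny
quotient `A′ = A∕C` in [RapoportSmithlingZhang2020Diagonal] (4.23) p. 21 and of [HarrisTaylorAMS2001] p. 110).

## Contents

* §1 `translation_comp_i_comp_quotientMk` (invariance), **`RingAction.quotientI`** (`ρ′(a)` as a bare morphism) with **`quotientMk_comp_quotientI`**
  (`ψ ≫ ρ′(a) = ρ(a) ≫ ψ`), `quotientI_unique`, `isMonHom_quotientI`, `quotientI_one`, `quotientI_mul`, `quotientI_zero`, `quotientI_add`.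
* §2 **`RingAction.quotient : RingAction O (A.quotientBy u K hcov hG hsm hgc)`** (the package), `quotient_i` (`rfl` bookkeeping),
  **`quotientMk_comp_quotient_i`** (EQUIVARIANCE of `ψ`), `quotient_i_unique` (any `g` with `ψ ≫ g = ρ(a) ≫ ψ` is `ρ′(a)`),
  `comp_quotient_i_eq_of_comp_eq` (equivariance transported to any `φ = x ≫ ψ`).

## References
* [MumfordAV1970] D. Mumford, *Abelian Varieties* (1970), §7 Thm. 4 (p. 72).
* [Kottwitz1992] R. Kottwitz, *Points on some Shimura varieties over finite fields*, JAMS 5 (1992), §5 (p. 390).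
* [RapoportSmithlingZhang2020Diagonal] M. Rapoport, B. Smithling, W. Zhang, *Arithmetic diagonal cycles on unitary Shimura varieties* (2020), §4, (4.23) (p. 21).
* [HarrisTaylorAMS2001] M. Harris, R. Taylor, *The Geometry and Cohomology of Some Simple Shimura Varieties* (2001), §III.4 (p. 110).
-/

set_option autoImplicit false

noncomputable section

universe u

open CategoryTheory CategoryTheory.Limits AlgebraicGeometry MonoidalCategory CartesianMonoidalCategory
open scoped MonObj

namespace Literature.AlgebraicGeometry.AbelianSchemes

namespace AbelianSchemeOver

variable {S : Scheme.{u}} (A : AbelianSchemeOver S)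
  {Y : Scheme.{u}} (u : S ⟶ Y) (K : Subgroup A.Sections) [Finite K] [Y.IsSeparated] [IsSeparated (A.X.hom ≫ u)]
  [S.IsSeparated] (hcov : ∀ x : A.left, ∃ O : (A.translationActionOver u K).StableAffineOpens, x ∈ O.1)
  [LocallyOfFiniteType (A.X.hom ≫ u)] [IsLocallyNoetherian Y] [IsAffine Y]
  (hG : ∃ _ : GrpObj (A.quotientOver u K), IsMonHom (A.quotientMk u K hcov))
  (hsm : Smooth (A.quotientOver u K).hom) (hgc : GeometricallyConnected (A.quotientOver u K).hom)
  (hfree : ∀ (Ω : Type u) [Field Ω] [IsAlgClosed Ω] (x : Spec (.of Ω) ⟶ A.left) (σ : K), σ ≠ 1 →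
    x ≫ (A.translation (σ : A.Sections)).left ≠ x)
  {O : Type*} [CommRing O] (ρ : A.RingAction O)
  (hρK : ∀ (a : O) (σ : A.Sections), σ ∈ K → σ ≫ ρ.i a ∈ K)

/-! ## §1 `ρ(a) ≫ ψ` is `K`-invariant and descends -/

section Descend

omit [LocallyOfFiniteType (A.X.hom ≫ u)] [IsLocallyNoetherian Y] [IsAffine Y] in
include hρK in
/-- **Invariance**: for `σ ∈ K`, `t_σ ≫ ρ(a) ≫ ψ = ρ(a) ≫ ψ` (`ρ(a)` carries `t_σ` to `t_{σ ≫ ρ(a)}` and `σ ≫ ρ(a) ∈ K` is killed by `ψ`).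
[cite: MumfordAV1970, §7 Thm. 4 (p. 72)] -/
theorem translation_comp_i_comp_quotientMk (a : O) (σ : K) :
    A.translation (σ : A.Sections) ≫ ρ.i a ≫ A.quotientMk u K hcov = ρ.i a ≫ A.quotientMk u K hcov := by
  haveI := ρ.isMonHom a
  rw [← Category.assoc, A.translation_comp_of_isMonHom (ρ.i a) (σ : A.Sections), Category.assoc,
    A.translation_comp_quotientMk u K hcov ⟨(σ : A.Sections) ≫ ρ.i a, hρK a σ σ.2⟩]

/-- **`ρ′(a) : A∕K → A∕K`**, the descent of `ρ(a) ≫ ψ` along `ψ` (★ `homDesc`). [cite: MumfordAV1970, §7 Thm. 4 (p. 72)] -/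
def RingAction.quotientI (a : O) : A.quotientOver u K ⟶ A.quotientOver u K :=
  haveI := A.isSeparated_quotientOver_left u K hcov
  A.homDesc u K hcov (ρ.i a ≫ A.quotientMk u K hcov) (A.translation_comp_i_comp_quotientMk u K hcov ρ hρK a)

omit [LocallyOfFiniteType (A.X.hom ≫ u)] [IsLocallyNoetherian Y] [IsAffine Y] in
/-- **`ψ ≫ ρ′(a) = ρ(a) ≫ ψ`.** [cite: MumfordAV1970, §7 Thm. 4 (p. 72)] -/
@[reassoc]
theorem RingAction.quotientMk_comp_quotientI (a : O) :
    A.quotientMk u K hcov ≫ RingAction.quotientI A u K hcov ρ hρK a = ρ.i a ≫ A.quotientMk u K hcov := by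
  haveI := A.isSeparated_quotientOver_left u K hcov
  exact A.quotientMk_comp_homDesc u K hcov _ _

omit [LocallyOfFiniteType (A.X.hom ≫ u)] [IsLocallyNoetherian Y] in
include hfree in
/-- **Uniqueness**: any `g : A∕K → A∕K` with `ψ ≫ g = ρ(a) ≫ ψ` is `ρ′(a)` (`ψ` is an epimorphism, `Y` affine, `K` free).
[cite: MumfordAV1970, §7 Thm. 4 (p. 72)] -/
theorem RingAction.quotientI_unique (a : O) (g : A.quotientOver u K ⟶ A.quotientOver u K)
    (hg : A.quotientMk u K hcov ≫ g = ρ.i a ≫ A.quotientMk u K hcov) : g = RingAction.quotientI A u K hcov ρ hρK a := by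
  haveI := A.epi_quotientMk u K hcov hfree
  rw [← cancel_epi (A.quotientMk u K hcov), hg, RingAction.quotientMk_comp_quotientI]

include hfree in
/-- `ρ′(a)` is a homomorphism for the group law of `A∕K` (★ `isMonHom_homDesc`). [cite: MumfordAV1970, §7 Thm. 4 (p. 72)] -/
theorem RingAction.isMonHom_quotientI (a : O) :
    letI : GrpObj (A.quotientOver u K) := (A.quotientBy u K hcov hG hsm hgc).grpObj
    IsMonHom (RingAction.quotientI A u K hcov ρ hρK a) := by
  letI : GrpObj (A.quotientOver u K) := (A.quotientBy u K hcov hG hsm hgc).grpObj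
  haveI := A.isMonHom_quotientMk u K hcov hG hsm hgc
  haveI := ρ.isMonHom a
  haveI := A.isSeparated_quotientOver_left u K hcov
  exact A.isMonHom_homDesc u K hcov _ _ hG hsm hgc hfree

omit [LocallyOfFiniteType (A.X.hom ≫ u)] [IsLocallyNoetherian Y] in
include hfree in
/-- `ρ′(1) = 𝟙`. [cite: MumfordAV1970, §7 Thm. 4 (p. 72)] -/
theorem RingAction.quotientI_one : RingAction.quotientI A u K hcov ρ hρK 1 = 𝟙 (A.quotientOver u K) :=
  (RingAction.quotientI_unique A u K hcov hfree ρ hρK 1 (𝟙 _) (by rw [Category.comp_id, ρ.i_one, Category.id_comp])).symm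

omit [LocallyOfFiniteType (A.X.hom ≫ u)] [IsLocallyNoetherian Y] in
include hfree in
/-- `ρ′(ab) = ρ′(b) ≫ ρ′(a)`. [cite: MumfordAV1970, §7 Thm. 4 (p. 72)] -/
theorem RingAction.quotientI_mul (a b : O) :
    RingAction.quotientI A u K hcov ρ hρK (a * b) =
      RingAction.quotientI A u K hcov ρ hρK b ≫ RingAction.quotientI A u K hcov ρ hρK a :=
  (RingAction.quotientI_unique A u K hcov hfree ρ hρK (a * b) _ (by
    rw [RingAction.quotientMk_comp_quotientI_assoc, RingAction.quotientMk_comp_quotientI, ← Category.assoc, ← ρ.i_mul])).symm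

include hfree in
/-- `ρ′(0) = 1` (the unit of the group `Hom_S(A∕K, A∕K)`). [cite: MumfordAV1970, §7 Thm. 4 (p. 72)] -/
theorem RingAction.quotientI_zero :
    letI : GrpObj (A.quotientOver u K) := (A.quotientBy u K hcov hG hsm hgc).grpObj
    RingAction.quotientI A u K hcov ρ hρK 0 = 1 := by
  letI : GrpObj (A.quotientOver u K) := (A.quotientBy u K hcov hG hsm hgc).grpObj
  haveI := A.isMonHom_quotientMk u K hcov hG hsm hgc
  refine (RingAction.quotientI_unique A u K hcov hfree ρ hρK 0 1 ?_).symm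
  rw [MonObj.comp_one, ρ.i_zero, MonObj.one_comp]

include hfree in
/-- `ρ′(a + b) = ρ′(a) · ρ′(b)` in the group `Hom_S(A∕K, A∕K)`. [cite: MumfordAV1970, §7 Thm. 4 (p. 72)] -/
theorem RingAction.quotientI_add (a b : O) :
    letI : GrpObj (A.quotientOver u K) := (A.quotientBy u K hcov hG hsm hgc).grpObj
    RingAction.quotientI A u K hcov ρ hρK (a + b) =
      RingAction.quotientI A u K hcov ρ hρK a * RingAction.quotientI A u K hcov ρ hρK b := by
  letI : GrpObj (A.quotientOver u K) := (A.quotientBy u K hcov hG hsm hgc).grpObj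
  haveI := A.isMonHom_quotientMk u K hcov hG hsm hgc
  refine (RingAction.quotientI_unique A u K hcov hfree ρ hρK (a + b) _ ?_).symm
  rw [MonObj.comp_mul, RingAction.quotientMk_comp_quotientI, RingAction.quotientMk_comp_quotientI, ← MonObj.mul_comp, ← ρ.i_add]

end Descend

/-! ## §2 The package: `ρ′` is a ring action on `A∕K` and `ψ` is `𝒪`-equivariant -/

section Package

/-- **THE `𝒪`-ACTION ON `A∕K`** induced by `ρ` (`K` being `ρ`-stable): `(ρ′).i a = homDesc (ρ(a) ≫ ψ)`.
[cite: MumfordAV1970, §7 Thm. 4 (p. 72)] [cite: RapoportSmithlingZhang2020Diagonal, §4 (4.23) (p. 21)] -/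
def RingAction.quotient : (A.quotientBy u K hcov hG hsm hgc).RingAction O where
  i a := RingAction.quotientI A u K hcov ρ hρK a
  isMonHom a := RingAction.isMonHom_quotientI A u K hcov hG hsm hgc hfree ρ hρK a
  i_one := RingAction.quotientI_one A u K hcov hfree ρ hρK
  i_mul a b := RingAction.quotientI_mul A u K hcov hfree ρ hρK a b
  i_zero := RingAction.quotientI_zero A u K hcov hG hsm hgc hfree ρ hρK
  i_add a b := RingAction.quotientI_add A u K hcov hG hsm hgc hfree ρ hρK a b

/-- Bookkeeping: `(ρ′).i a` is `quotientI a` (`rfl`). [cite: MumfordAV1970, §7 Thm. 4 (p. 72)] -/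
theorem RingAction.quotient_i (a : O) :
    (RingAction.quotient A u K hcov hG hsm hgc hfree ρ hρK).i a = RingAction.quotientI A u K hcov ρ hρK a := rfl

/-- **EQUIVARIANCE of the quotient map: `ψ ≫ ρ′(a) = ρ(a) ≫ ψ`** (as morphisms `A.X ⟶ (A∕K).X`).
[cite: MumfordAV1970, §7 Thm. 4 (p. 72)] [cite: RapoportSmithlingZhang2020Diagonal, §4 (4.23) (p. 21)] -/
theorem RingAction.quotientMk_comp_quotient_i (a : O) :
    A.quotientMk u K hcov ≫ (RingAction.quotient A u K hcov hG hsm hgc hfree ρ hρK).i a = ρ.i a ≫ A.quotientMk u K hcov :=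
  RingAction.quotientMk_comp_quotientI A u K hcov ρ hρK a

/-- **Uniqueness of `ρ′`**: any endomorphism `g` of `A∕K` over `S` with `ψ ≫ g = ρ(a) ≫ ψ` equals `ρ′(a)`. [cite: MumfordAV1970, §7 Thm. 4 (p. 72)] -/
theorem RingAction.quotient_i_unique (a : O) (g : (A.quotientBy u K hcov hG hsm hgc).X ⟶ (A.quotientBy u K hcov hG hsm hgc).X)
    (hg : A.quotientMk u K hcov ≫ g = ρ.i a ≫ A.quotientMk u K hcov) :
    g = (RingAction.quotient A u K hcov hG hsm hgc hfree ρ hρK).i a :=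
  RingAction.quotientI_unique A u K hcov hfree ρ hρK a g hg

/-- Equivariance read on points through `ψ`: for `x : T ⟶ A.X`, `(x ≫ ψ) ≫ ρ′(a) = (x ≫ ρ(a)) ≫ ψ`. [cite: MumfordAV1970, §7 Thm. 4 (p. 72)] -/
theorem RingAction.comp_quotientMk_comp_quotient_i {T : Over S} (x : T ⟶ A.X) (a : O) :
    (x ≫ A.quotientMk u K hcov) ≫ (RingAction.quotient A u K hcov hG hsm hgc hfree ρ hρK).i a = (x ≫ ρ.i a) ≫ A.quotientMk u K hcov := by
  rw [Category.assoc, Category.assoc]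
  exact x ≫= RingAction.quotientMk_comp_quotient_i A u K hcov hG hsm hgc hfree ρ hρK a

end Package

end AbelianSchemeOver

end Literature.AlgebraicGeometry.AbelianSchemes
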